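import Literature.Topology.FourManifolds.KirbyMovesSurgery
import Literature.Topology.FourManifolds.KirbyMovesBlowDown
import Literature.Topology.FourManifolds.TubularNbhdRotationDegree
import Literature.Topology.FourManifolds.LinkTubularUntwist
import HarnessLib

/-!
# Uniqueness of Dehn surgery on a framed link: discharge of `FramedLink.IsSurgery.nonempty_diffeomorph`

Sibling proof file of `KirbyMovesSurgery.lean`. It **discharges leaf (U)** of the decomposition of
Kirby's theorem recorded there:

* `Literature.Topology.FourManifolds.FramedLink.IsSurgery.nonempty_diffeomorph_holds :
  FramedLink.IsSurgery.nonempty_diffeomorph` — two smooth 3-manifolds `Y`, `Y'` (any universes)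
  which are both surgery on the same framed link `L` in `S³` (`FramedLink.IsSurgery (𝓡 3)`, the
  relational integral Dehn surgery `IsIntegralSurgeryLink` of `DehnSurgery.lean`: some family of
  pairwise disjoint oriented tubular neighbourhoods `νᵢ` with the framings of `L` presents the
  manifold as the gluing of the link complement and one open solid torus per component) are
  diffeomorphic. D. Rolfsen, *Knots and Links* (1976), §9.F: "the resulting space depends only on
  the framed link"; Gompf–Stipsicz (1999), §5.3.

## The proof

Let `(ν, jA, jB)` present `Y` and `(ν', jA', jB')` present `Y'` (framings `mᵢ` on both sides).

1. *Tubular neighbourhoods agree near the link up to rotations* (`LinkTubularUntwist.lean`,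
   `Link.exists_diffeomorph_tubularNbhd_rotate`, from the uniqueness of tubular neighbourhoods up
   to a rotation field, Hirsch (1976), Ch. 4 §5 Thm. 5.3, Ch. 8 §1 Thm. 1.3, and the untwisting of
   its null-homotopic part): a diffeomorphism `ψ` of `S³` fixing `L` pointwise, `0 < r ≤ 1` and
   integers `dᵢ` with `ψ (νᵢ (e^{iθ}, w)) = ν'ᵢ (e^{iθ}, R(dᵢ θ) w)` for `‖w‖ < r`.
2. *The degrees vanish* (`TubularNbhdRotationDegree.lean`, `HasFraming.eq_sub_of_rotate`: the
   degree of the rotation field is the difference of the framing integers, which agree), in the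
   small-radius form `Literature.Topology.FourManifolds.Knot.TubularNbhd.HasFraming.eq_sub_of_rotate_smul`
   proved here by composing with continuous fibre rescalings of `S³` along a tubular neighbourhood
   (`Literature.Topology.FourManifolds.Knot.TubularNbhd.exists_continuous_fibreMap`: `ν ∘ (id × φ) ∘ ν⁻¹` extended by
   the identity, for a continuous fibre map `φ` equal to the identity off the unit disc). Hence
   `ψ ∘ νᵢ = ν'ᵢ` on the tubes of radius `r`.
3. *Restriction of the solid tori* (`Literature.Topology.FourManifolds.Link.IsSurgeryPresentation.restrict_solidTori`): the
   surgery only uses the open disc bundle of radius `r`: restricting each solid torus embedding to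
   the open solid torus of radius `r` (reparametrised over the whole open solid torus by the fibre
   dilation) gives an open multi-gluing of the link complement and one solid torus per component
   with the relations `νᵢ.glueRel a (r • p, v)`; the dropped annuli `{r ≤ ‖p‖ < 1}` are covered by
   the link complement (Rolfsen (1976), §9.F: surgery with a tubular neighbourhood "of any
   radius"; Kosinski (1993), III.(3.4)).
4. *Comparison*: precomposing `jA` with `ψ⁻¹` on the link complement turns the relations of `Y`
   into those of `Y'` (by 2), and two open multi-gluings of the same pieces along the same
   relations are diffeomorphic (`nonempty_diffeomorph_of_multiGluing`, `LinkSurgeryUniqueness.lean`;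
   Kosinski (1993), VI.1).

## References

* D. Rolfsen, *Knots and Links*, Publish or Perish (1976), §9.F. [cite: Rolfsen1976, §9.F]
* R. E. Gompf, A. I. Stipsicz, *4-Manifolds and Kirby Calculus*, GSM 20 (1999), §4.5, §5.3.
  [cite: GompfStipsicz1999, §5.3]
* M. W. Hirsch, *Differential Topology*, GTM 33 (1976), Ch. 4 §5 Thm. 5.3. [cite: Hirsch1976, Ch. 4 §5 Thm. 5.3]
* A. Kosinski, *Differential Manifolds* (1993), Ch. III (3.4), Ch. VI §1. [cite: Kosinski1993, Ch. VI §1, proof of Thm (1.1)]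

## Design notes

* The file declares theorems only (the fibre rescalings and the dilation of the solid torus are
  produced by existence statements), and depends only on proved tree files.
* No declaration in this file uses `sorry`; `FramedLink.IsSurgery.nonempty_diffeomorph_holds`
  depends only on the axioms `propext`, `Classical.choice`, `Quot.sound`.
-/

noncomputable section

open Set Function
open scoped Manifold ContDiff Topology

namespace Literature.Topology.FourManifolds

/-! ### Continuous fibre maps of a tube, extended to `S³` by the identity -/

namespace Knot.TubularNbhd

section FibreMap

variable {K : Metric.sphere (0 : EuclideanSpace ℝ (Fin 2)) 1 → Metric.sphere (0 : EuclideanSpace ℝ (Fin 4)) 1}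

/-- **A continuous fibre map of the tube, pushed into `S³`.** Let `ν` be a tubular neighbourhood
of the knot `K` and `φ : ℝ² → ℝ²` continuous with `φ w ≠ 0` for `w ≠ 0` and `φ w = w` for
`‖w‖ ≥ 1`. Then `ν (x, w) ↦ ν (x, φ w)` on the image of `ν`, extended by the identity, is a
continuous self-map `E` of `S³` carrying the knot complement into itself (it is continuous on the
open image of `ν` and the identity off the compact `ν (S¹ × D̄²)`). Used with radial rescalings
`φ w = ρ(‖w‖) w` to compare framings at different radii. [folklore] -/
theorem exists_continuous_fibreMap (ν : Knot.TubularNbhd K)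
    {φ : EuclideanSpace ℝ (Fin 2) → EuclideanSpace ℝ (Fin 2)} (hφ : Continuous φ)
    (hφ0 : ∀ w, w ≠ 0 → φ w ≠ 0) (hφ1 : ∀ w, 1 ≤ ‖w‖ → φ w = w) :
    ∃ E : Metric.sphere (0 : EuclideanSpace ℝ (Fin 4)) 1 → Metric.sphere (0 : EuclideanSpace ℝ (Fin 4)) 1,
      Continuous E ∧ MapsTo E (range K)ᶜ (range K)ᶜ ∧ ∀ x w, E (ν (x, w)) = ν (x, φ w) := by
  classical
  let F : (Metric.sphere (0 : EuclideanSpace ℝ (Fin 2)) 1) × EuclideanSpace ℝ (Fin 2) →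
      Metric.sphere (0 : EuclideanSpace ℝ (Fin 4)) 1 := fun q ↦ ν (q.1, φ q.2)
  have hF : Continuous F := ν.continuous.comp (continuous_fst.prodMk (hφ.comp continuous_snd))
  let E : Metric.sphere (0 : EuclideanSpace ℝ (Fin 4)) 1 → Metric.sphere (0 : EuclideanSpace ℝ (Fin 4)) 1 :=
    fun p ↦ if p ∈ range ν then F (ν.toHomeo.symm p) else p
  have hEν : ∀ q, E (ν q) = F q := fun q ↦ by
    simp only [E, if_pos (mem_range_self q), toHomeo_symm_apply]
  have hEout : ∀ p, p ∉ range ν → E p = p := fun p hp ↦ if_neg hp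
  refine ⟨E, ?_, ?_, fun x w ↦ hEν (x, w)⟩
  · rw [continuous_iff_continuousAt]
    intro p
    by_cases hp : p ∈ range ν
    · -- on the open image of `ν`, `E = F ∘ ν⁻¹`
      have hcont : ContinuousOn E (range ν) := by
        have h1 : ContinuousOn (F ∘ ν.toHomeo.symm) (range ν) := by
          refine hF.comp_continuousOn (ν.toHomeo.continuousOn_symm.mono ?_)
          rw [toHomeo_target]
        exact h1.congr fun q hq ↦ if_pos hq
      exact hcont.continuousAt (ν.isOpenMap.isOpen_range.mem_nhds hp)
    · -- off the compact closed unit tube, `E = id`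
      have hK : IsCompact (ν '' (univ ×ˢ Metric.closedBall (0 : EuclideanSpace ℝ (Fin 2)) 1)) :=
        (isCompact_univ.prod (isCompact_closedBall _ _)).image ν.continuous
      have hpK : p ∉ ν '' (univ ×ˢ Metric.closedBall (0 : EuclideanSpace ℝ (Fin 2)) 1) :=
        fun ⟨q, _, hq⟩ ↦ hp ⟨q, hq⟩
      have hev : E =ᶠ[𝓝 p] id := by
        filter_upwards [hK.isClosed.isOpen_compl.mem_nhds hpK] with q hq
        by_cases hq' : q ∈ range ν
        · obtain ⟨⟨x, v⟩, rfl⟩ := hq'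
          have hv : 1 ≤ ‖v‖ := by
            by_contra hlt
            exact hq ⟨(x, v), ⟨mem_univ _, Metric.mem_closedBall.2
              (by rw [dist_zero_right]; exact (not_le.1 hlt).le)⟩, rfl⟩
          rw [hEν]
          simp only [F, hφ1 v hv, id]
        · exact hEout q hq'
      exact continuousAt_id.congr hev.symm
  · intro p hp hpK
    by_cases hp' : p ∈ range ν
    · obtain ⟨⟨x, v⟩, rfl⟩ := hp'
      rw [hEν] at hpK
      have hv : v ≠ 0 := fun hv0 ↦ hp (by rw [hv0, ν.coe_apply_zero]; exact mem_range_self x)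
      exact ν.apply_mem_compl_range (hφ0 v hv) hpK
    · rw [hEout p hp'] at hpK
      exact hp hpK

end FibreMap

/-! ### The degree of the rotation field, detected at a small radius -/

section SmallRadius

variable {K : Knot}

/-- **The degree of a fibre rotation relating two tubular neighbourhoods is the difference of
their framings, small-radius form.** As `HasFraming.eq_sub_of_rotate`, but with the relation
`g (ν (circlePoint θ, w)) = ν' (circlePoint θ, c • rotPlane (dθ) w)` (`‖w‖ ≤ ½`) landing in the
tube of radius `c/2` of `ν'`, `0 < c ≤ 1`: compose `g` with the continuous fibre rescaling of `S³`
along `ν'` which is `v ↦ c⁻¹ v` on the disc of radius `c` (`exists_continuous_fibreMap`) and apply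
`HasFraming.eq_sub_of_rotate`. Rolfsen (1976), §9.F; Gompf–Stipsicz (1999), §4.5.
[cite: GompfStipsicz1999, §4.5] -/
theorem HasFraming.eq_sub_of_rotate_smul {ν ν' : Knot.TubularNbhd K} {m m' : ℤ}
    (h : ν.HasFraming m) (h' : ν'.HasFraming m')
    {g : Metric.sphere (0 : EuclideanSpace ℝ (Fin 4)) 1 → Metric.sphere (0 : EuclideanSpace ℝ (Fin 4)) 1}
    (hg : Continuous g) (hgK : MapsTo g (range K)ᶜ (range K)ᶜ) (d : ℤ) {c : ℝ} (hc : 0 < c)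
    (hc1 : c ≤ 1) (hrel : ∀ (θ : ℝ) (w : EuclideanSpace ℝ (Fin 2)), ‖w‖ ≤ 1 / 2 →
      g (ν (circlePoint θ, w)) = ν' (circlePoint θ, c • rotPlane (d * θ) w)) :
    m' = m - d := by
  -- the unsqueezing profile `v ↦ (max c (min ‖v‖ 1))⁻¹ • v`
  set φ : EuclideanSpace ℝ (Fin 2) → EuclideanSpace ℝ (Fin 2) :=
    fun v ↦ (max c (min ‖v‖ 1))⁻¹ • v with hφ
  have hpos : ∀ v : EuclideanSpace ℝ (Fin 2), 0 < max c (min ‖v‖ 1) := fun v ↦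
    hc.trans_le (le_max_left _ _)
  have hφc : Continuous φ :=
    ((continuous_const.max ((continuous_norm).min continuous_const)).inv₀
      fun v ↦ (hpos v).ne').smul continuous_id
  have hφ0 : ∀ v, v ≠ 0 → φ v ≠ 0 := fun v hv ↦ smul_ne_zero (inv_ne_zero (hpos v).ne') hv
  have hφ1 : ∀ v, 1 ≤ ‖v‖ → φ v = v := fun v hv ↦ by
    rw [hφ]
    dsimp only
    rw [min_eq_right hv, max_eq_right hc1, inv_one, one_smul]
  have hφs : ∀ v, ‖v‖ ≤ c → φ v = c⁻¹ • v := fun v hv ↦ by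
    rw [hφ]
    dsimp only
    rw [max_eq_left ((min_le_left _ _).trans hv)]
  obtain ⟨E, hE, hEK, hEν⟩ := ν'.exists_continuous_fibreMap hφc hφ0 hφ1
  refine HasFraming.eq_sub_of_rotate h h' (hE.comp hg) (hEK.comp hgK) d fun θ w hw ↦ ?_
  have hnorm : ‖c • rotPlane (d * θ) w‖ ≤ c := by
    rw [norm_smul, norm_rotPlane, Real.norm_of_nonneg hc.le]
    nlinarith
  rw [comp_apply, hrel θ w hw, hEν, hφs _ hnorm, smul_smul, inv_mul_cancel₀ hc.ne', one_smul]

end SmallRadius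

end Knot.TubularNbhd

/-! ### Restricting the solid tori of a surgery presentation -/

section Restrict

variable {EY HY : Type*} [NormedAddCommGroup EY] [NormedSpace ℝ EY] [TopologicalSpace HY]
  {IY : ModelWithCorners ℝ EY HY} {Y : Type*} [TopologicalSpace Y] [ChartedSpace HY Y]
  {ι : Type*} [Finite ι]

/-- **Restricting the solid tori of a surgery presentation to radius `r`.** If `Y` is surgery on
`L` presented with pairwise disjoint tubular neighbourhoods `νᵢ` (`Link.IsSurgeryPresentation`),
then for `0 < r ≤ 1` the link complement and the solid tori *of radius `r`*, the latter
reparametrised over the whole open solid torus by the dilation `(p, v) ↦ (r p, v)`, still form an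
open multi-gluing of `Y`, now along the relations `νᵢ.glueRel a (r • p, v)` (which only involve
the tubes `νᵢ (S¹ × B_r)`): the annuli `jBᵢ {r ≤ ‖p‖ < 1}` are covered by the link complement,
being glued to `νᵢ (u, t • v)` with `t ≥ r`, a point off every component by disjointness of the
`νⱼ`. Rolfsen (1976), §9.F (the surgery uses a tubular neighbourhood of any radius); Kosinski
(1993), III.(3.4). [cite: Rolfsen1976, §9.F] -/
theorem Link.IsSurgeryPresentation.restrict_solidTori {L : Link ι}
    {ν : ∀ i, Knot.TubularNbhd (L.component i)}
    (hdisj : Pairwise fun i j ↦ Disjoint (range (ν i)) (range (ν j)))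
    (h : L.IsSurgeryPresentation IY Y ν) (r : ℝ) (hr : 0 < r) (hr1 : r ≤ 1) :
    ∃ (jA : L.complement → Y) (jB : ι → solidTorus → Y),
      Manifold.IsSmoothEmbedding (𝓡 3) IY ∞ jA ∧ IsOpen (range jA) ∧
      (∀ i, Manifold.IsSmoothEmbedding (𝓘(ℝ, EuclideanSpace ℝ (Fin 2)).prod (𝓡 1)) IY ∞ (jB i) ∧
        IsOpen (range (jB i))) ∧
      range jA ∪ (⋃ i, range (jB i)) = univ ∧
      (Pairwise fun i j ↦ Disjoint (range (jB i)) (range (jB j))) ∧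
      ∀ i a (b : solidTorus), jA a = jB i b ↔ (ν i).glueRel a
        (r • (b : EuclideanSpace ℝ (Fin 2) × Metric.sphere (0 : EuclideanSpace ℝ (Fin 2)) 1).1,
          (b : EuclideanSpace ℝ (Fin 2) × Metric.sphere (0 : EuclideanSpace ℝ (Fin 2)) 1).2) := by
  obtain ⟨jA, jB, hA, hAo, hB, hcov, hBdisj, hglue⟩ := h
  -- the open solid torus of radius `r` and the dilation onto it
  let Tr : TopologicalSpace.Opens (EuclideanSpace ℝ (Fin 2) × Metric.sphere (0 : EuclideanSpace ℝ (Fin 2)) 1) :=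
    ⟨{p | ‖p.1‖ < r}, isOpen_lt (continuous_norm.comp continuous_fst) continuous_const⟩
  have hTr : Tr ≤ solidTorus := fun p hp ↦ (mem_solidTorus_iff p).2 (lt_of_lt_of_le hp hr1)
  have hsm : ContMDiff (𝓘(ℝ, EuclideanSpace ℝ (Fin 2)).prod (𝓡 1))
      (𝓘(ℝ, EuclideanSpace ℝ (Fin 2)).prod (𝓡 1)) ∞
      fun p : EuclideanSpace ℝ (Fin 2) × Metric.sphere (0 : EuclideanSpace ℝ (Fin 2)) 1 ↦
        (r • p.1, p.2) :=
    ((contDiff_id.const_smul r).contMDiff.comp contMDiff_fst).prodMk contMDiff_snd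
  have hsm' : ContMDiff (𝓘(ℝ, EuclideanSpace ℝ (Fin 2)).prod (𝓡 1))
      (𝓘(ℝ, EuclideanSpace ℝ (Fin 2)).prod (𝓡 1)) ∞
      fun p : EuclideanSpace ℝ (Fin 2) × Metric.sphere (0 : EuclideanSpace ℝ (Fin 2)) 1 ↦
        (r⁻¹ • p.1, p.2) :=
    ((contDiff_id.const_smul r⁻¹).contMDiff.comp contMDiff_fst).prodMk contMDiff_snd
  have hmemT : ∀ b : solidTorus, ((r • (b : EuclideanSpace ℝ (Fin 2) ×
      Metric.sphere (0 : EuclideanSpace ℝ (Fin 2)) 1).1, (b : EuclideanSpace ℝ (Fin 2) ×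
        Metric.sphere (0 : EuclideanSpace ℝ (Fin 2)) 1).2) : EuclideanSpace ℝ (Fin 2) ×
          Metric.sphere (0 : EuclideanSpace ℝ (Fin 2)) 1) ∈ Tr := fun b ↦ by
    change ‖r • _‖ < r
    rw [norm_smul, Real.norm_of_nonneg hr.le]
    exact mul_lt_of_lt_one_right hr ((mem_solidTorus_iff _).1 b.2)
  have hmemS : ∀ b : Tr, ((r⁻¹ • (b : EuclideanSpace ℝ (Fin 2) ×
      Metric.sphere (0 : EuclideanSpace ℝ (Fin 2)) 1).1, (b : EuclideanSpace ℝ (Fin 2) ×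
        Metric.sphere (0 : EuclideanSpace ℝ (Fin 2)) 1).2) : EuclideanSpace ℝ (Fin 2) ×
          Metric.sphere (0 : EuclideanSpace ℝ (Fin 2)) 1) ∈ solidTorus := fun b ↦ by
    rw [mem_solidTorus_iff, norm_smul, Real.norm_of_nonneg (inv_nonneg.2 hr.le)]
    have hb : ‖(b : EuclideanSpace ℝ (Fin 2) × Metric.sphere (0 : EuclideanSpace ℝ (Fin 2)) 1).1‖ < r :=
      b.2
    calc r⁻¹ * ‖(b : EuclideanSpace ℝ (Fin 2) × Metric.sphere (0 : EuclideanSpace ℝ (Fin 2)) 1).1‖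
        < r⁻¹ * r := mul_lt_mul_of_pos_left hb (inv_pos.2 hr)
      _ = 1 := inv_mul_cancel₀ hr.ne'
  let D : solidTorus ≃ₘ⟮𝓘(ℝ, EuclideanSpace ℝ (Fin 2)).prod (𝓡 1),
      𝓘(ℝ, EuclideanSpace ℝ (Fin 2)).prod (𝓡 1)⟯ Tr :=
    { toFun := fun b ↦ ⟨_, hmemT b⟩
      invFun := fun b ↦ ⟨_, hmemS b⟩
      left_inv := fun b ↦ Subtype.ext (Prod.ext (by
        change r⁻¹ • r • _ = _
        rw [smul_smul, inv_mul_cancel₀ hr.ne', one_smul]) rfl)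
      right_inv := fun b ↦ Subtype.ext (Prod.ext (by
        change r • r⁻¹ • _ = _
        rw [smul_smul, mul_inv_cancel₀ hr.ne', one_smul]) rfl)
      contMDiff_toFun := (ContMDiff.subtypeVal_comp_iff Tr _).1 (hsm.comp contMDiff_subtype_val)
      contMDiff_invFun :=
        (ContMDiff.subtypeVal_comp_iff solidTorus _).1 (hsm'.comp contMDiff_subtype_val) }
  have hDval : ∀ b : solidTorus, ((TopologicalSpace.Opens.inclusion hTr (D b) : solidTorus) :
      EuclideanSpace ℝ (Fin 2) × Metric.sphere (0 : EuclideanSpace ℝ (Fin 2)) 1) =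
        (r • (b : EuclideanSpace ℝ (Fin 2) × Metric.sphere (0 : EuclideanSpace ℝ (Fin 2)) 1).1,
          (b : EuclideanSpace ℝ (Fin 2) × Metric.sphere (0 : EuclideanSpace ℝ (Fin 2)) 1).2) :=
    fun _ ↦ rfl
  -- the restricted solid torus embeddings
  let jB' : ι → solidTorus → Y := fun i ↦ (jB i ∘ TopologicalSpace.Opens.inclusion hTr) ∘ D
  have hjB' : ∀ i b, jB' i b = jB i (TopologicalSpace.Opens.inclusion hTr (D b)) := fun _ _ ↦ rfl
  have hrange : ∀ i, range (jB' i) = range (jB i ∘ TopologicalSpace.Opens.inclusion hTr) := fun i ↦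
    D.surjective.range_comp _
  have hsub : ∀ i, range (jB' i) ⊆ range (jB i) := fun i ↦ by
    rw [hrange, range_comp]
    exact image_subset_range _ _
  refine ⟨jA, jB', hA, hAo, fun i ↦ ⟨?_, ?_⟩, ?_, fun i j hij ↦ (hBdisj hij).mono (hsub i) (hsub j),
    fun i a b ↦ ?_⟩
  · exact (isSmoothEmbedding_comp_inclusion hTr (hB i).1).1.comp_diffeomorph D
  · rw [hrange]
    exact (isSmoothEmbedding_comp_inclusion hTr (hB i).1).2 (hB i).2
  · -- the annuli `jB i {r ≤ ‖p‖ < 1}` are covered by the link complement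
    refine eq_univ_of_forall fun y ↦ ?_
    rcases (eq_univ_iff_forall.1 hcov y) with hy | hy
    · exact Or.inl hy
    · obtain ⟨i, b, rfl⟩ := mem_iUnion.1 hy
      by_cases hb : ‖(b : EuclideanSpace ℝ (Fin 2) × Metric.sphere (0 : EuclideanSpace ℝ (Fin 2)) 1).1‖ < r
      · refine Or.inr (mem_iUnion.2 ⟨i, D.symm ⟨b, hb⟩, ?_⟩)
        rw [hjB', Diffeomorph.apply_symm_apply]
        rfl
      · -- `b = (t • u, v)` with `r ≤ t < 1`: glued to `ν i (u, t • v)`, a point of the complement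
        set p := (b : EuclideanSpace ℝ (Fin 2) × Metric.sphere (0 : EuclideanSpace ℝ (Fin 2)) 1).1
          with hp
        set v := (b : EuclideanSpace ℝ (Fin 2) × Metric.sphere (0 : EuclideanSpace ℝ (Fin 2)) 1).2
          with hv
        have ht1 : ‖p‖ < 1 := (mem_solidTorus_iff _).1 b.2
        have ht0 : 0 < ‖p‖ := hr.trans_le (not_lt.1 hb)
        have hp0 : p ≠ 0 := norm_pos_iff.1 ht0
        let u : Metric.sphere (0 : EuclideanSpace ℝ (Fin 2)) 1 := ⟨‖p‖⁻¹ • p, by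
          rw [mem_sphere_zero_iff_norm, norm_smul, norm_inv, norm_norm, inv_mul_cancel₀ ht0.ne']⟩
        have hpu : p = ‖p‖ • (u : EuclideanSpace ℝ (Fin 2)) := by
          change p = ‖p‖ • ‖p‖⁻¹ • p
          rw [smul_smul, mul_inv_cancel₀ ht0.ne', one_smul]
        have hw : ‖p‖ • (v : EuclideanSpace ℝ (Fin 2)) ≠ 0 :=
          smul_ne_zero ht0.ne' (ne_zero_of_mem_unit_sphere v)
        have hmem : ν i (u, ‖p‖ • (v : EuclideanSpace ℝ (Fin 2))) ∈ L.complement := by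
          rw [Link.mem_complement_iff]
          intro j hj
          by_cases hji : j = i
          · subst hji
            exact (ν j).apply_mem_compl_range hw hj
          · exact Set.disjoint_left.1 (hdisj hji) ((ν j).range_subset_range hj) (mem_range_self _)
        refine Or.inl ⟨⟨_, hmem⟩, (hglue i _ b).2 ⟨u, ‖p‖, ⟨ht0, ht1⟩, hpu, rfl⟩⟩
  · rw [hjB', hglue i]
    rfl

end Restrict

/-! ### The discharge -/

section Discharge

universe v w u'

/-- **Uniqueness of surgery on a framed link** (discharge of the named fact
`FramedLink.IsSurgery.nonempty_diffeomorph` of `KirbyMovesSurgery.lean`, leaf (U) of the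
decomposition of Kirby's theorem): two smooth 3-manifolds `Y`, `Y'` which are both surgery on
the same framed link `L` are diffeomorphic. Given presentations `(ν, jA, jB)` of `Y` and
`(ν', jA', jB')` of `Y'`: (1) a diffeomorphism `ψ` of `S³` fixing `L` conjugates `νᵢ` to `ν'ᵢ`
up to rotations `R(dᵢ θ)` on the tubes of radius `r` (`Link.exists_diffeomorph_tubularNbhd_rotate`,
uniqueness of tubular neighbourhoods, Hirsch (1976), Ch. 4 §5 Thm. 5.3); (2) `dᵢ = 0` since the
framings agree (`HasFraming.eq_sub_of_rotate_smul`, the framing integer detects the degree of the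
rotation field, Rolfsen (1976), §9.F, Gompf–Stipsicz (1999), §4.5); (3) restrict the solid tori to
radius `r` (`Link.IsSurgeryPresentation.restrict_solidTori`) and precompose `jA` with `ψ⁻¹`, so
that `Y` and `Y'` are open multi-gluings of the link complement and the solid tori along the
*same* relations; (4) such gluings are diffeomorphic (`nonempty_diffeomorph_of_multiGluing`,
Kosinski (1993), VI.1). Rolfsen, *Knots and Links* (1976), §9.F ("the resulting space depends
only on the framed link"); Gompf–Stipsicz (1999), §5.3. [cite: Rolfsen1976, §9.F] -/
theorem FramedLink.IsSurgery.nonempty_diffeomorph_holds :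
    FramedLink.IsSurgery.nonempty_diffeomorph.{v, w, u'} := by
  intro ι _ L Y _ _ _ _ _ Y' _ _ _ _ _ hY hY'
  obtain ⟨ν, hfr, hdisj, hpres⟩ := hY
  obtain ⟨ν', hfr', hdisj', hpres'⟩ := hY'
  -- (1) conjugate up to the rotations `R(dᵢ θ)` on the tubes of radius `r`
  obtain ⟨ψ, hψL, r, hr, hr1, d, hψν⟩ :=
    L.toLink.exists_diffeomorph_tubularNbhd_rotate ν ν' hdisj hdisj'
  have hψK : ∀ i, MapsTo ψ (range (L.component i))ᶜ (range (L.component i))ᶜ :=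
    fun i p hp ⟨x, hx⟩ ↦ by
      have e : ψ (L.component i x) = ψ p := by rw [hψL, hx]
      exact hp ⟨x, ψ.injective e⟩
  -- (2) the degrees vanish, the framings being equal
  have hd : ∀ i, d i = 0 := fun i ↦ by
    -- the squeezing profile `w ↦ (r + (1 - r) σ(‖w‖)) • w`, `σ` the clamp of `2s - 1` to `[0, 1]`
    set φ : EuclideanSpace ℝ (Fin 2) → EuclideanSpace ℝ (Fin 2) :=
      fun w ↦ (r + (1 - r) * min 1 (max 0 (2 * ‖w‖ - 1))) • w with hφ
    have hcoef : ∀ w : EuclideanSpace ℝ (Fin 2), r ≤ r + (1 - r) * min 1 (max 0 (2 * ‖w‖ - 1)) :=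
      fun w ↦ le_add_of_nonneg_right (mul_nonneg (by linarith) (le_min zero_le_one (le_max_left _ _)))
    have hρ : Continuous fun w : EuclideanSpace ℝ (Fin 2) ↦
        r + (1 - r) * min 1 (max 0 (2 * ‖w‖ - 1)) :=
      continuous_const.add (continuous_const.mul (continuous_const.min
        (continuous_const.max ((continuous_const.mul continuous_norm).sub continuous_const))))
    have hφc : Continuous φ := hρ.smul continuous_id
    have hφ0 : ∀ w, w ≠ 0 → φ w ≠ 0 := fun w hw ↦
      smul_ne_zero (hr.trans_le (hcoef w)).ne' hw
    have hφ1 : ∀ w, 1 ≤ ‖w‖ → φ w = w := fun w hw ↦ by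
      rw [hφ]
      dsimp only
      rw [max_eq_right (by linarith), min_eq_left (by linarith)]
      simp
    have hφs : ∀ w, ‖w‖ ≤ 1 / 2 → φ w = r • w := fun w hw ↦ by
      rw [hφ]
      dsimp only
      rw [max_eq_left (by linarith), min_eq_right zero_le_one, mul_zero, add_zero]
    obtain ⟨S, hS, hSK, hSν⟩ := (ν i).exists_continuous_fibreMap hφc hφ0 hφ1
    have key := Knot.TubularNbhd.HasFraming.eq_sub_of_rotate_smul (hfr i) (hfr' i)
      (ψ.continuous.comp hS) ((hψK i).comp hSK) (d i) hr hr1 fun θ w hw ↦ by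
        have hrw : ‖r • w‖ < r := by
          rw [norm_smul, Real.norm_of_nonneg hr.le]
          exact mul_lt_of_lt_one_right hr (by linarith)
        rw [comp_apply, hSν, hφs w hw, hψν i θ (r • w) hrw, rotPlane_smul]
    omega
  have hconj : ∀ i (x : Metric.sphere (0 : EuclideanSpace ℝ (Fin 2)) 1) (w : EuclideanSpace ℝ (Fin 2)),
      ‖w‖ < r → ψ (ν i (x, w)) = ν' i (x, w) := fun i x w hw ↦ by
    obtain ⟨θ, rfl⟩ := circlePoint_surjective x
    rw [hψν i θ w hw, hd i, Int.cast_zero, zero_mul, rotPlane_zero]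
  -- (3) restrict the solid tori to radius `r` on both sides
  obtain ⟨jA, jB, hA, hAo, hB, hU, hBd, hR⟩ :=
    Link.IsSurgeryPresentation.restrict_solidTori hdisj hpres r hr hr1
  obtain ⟨jA', jB', hA', hAo', hB', hU', hBd', hR'⟩ :=
    Link.IsSurgeryPresentation.restrict_solidTori hdisj' hpres' r hr hr1
  -- (4) precompose `jA` with `ψ⁻¹`: both sides are glued along the relations of `ν'`
  have hglue : ∀ i a (b : solidTorus),
      (jA ∘ Link.complDiffeoSymm ψ L.toLink hψL) a = jB i b ↔ (ν' i).glueRel a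
        (r • (b : EuclideanSpace ℝ (Fin 2) × Metric.sphere (0 : EuclideanSpace ℝ (Fin 2)) 1).1,
          (b : EuclideanSpace ℝ (Fin 2) × Metric.sphere (0 : EuclideanSpace ℝ (Fin 2)) 1).2) := by
    intro i a b
    rw [comp_apply, hR i]
    change (ν i).glueRel (ψ.symm a) _ ↔ _
    have hb1 : ‖(b : EuclideanSpace ℝ (Fin 2) × Metric.sphere (0 : EuclideanSpace ℝ (Fin 2)) 1).1‖ < 1 :=
      (mem_solidTorus_iff _).1 b.2
    -- a gluing parameter `t` has `t = r ‖p‖ < r`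
    have ht : ∀ (u : Metric.sphere (0 : EuclideanSpace ℝ (Fin 2)) 1) (t : ℝ), t ∈ Ioo (0 : ℝ) 1 →
        r • (b : EuclideanSpace ℝ (Fin 2) × Metric.sphere (0 : EuclideanSpace ℝ (Fin 2)) 1).1 =
          t • (u : EuclideanSpace ℝ (Fin 2)) →
        ‖t • ((b : EuclideanSpace ℝ (Fin 2) × Metric.sphere (0 : EuclideanSpace ℝ (Fin 2)) 1).2 :
          EuclideanSpace ℝ (Fin 2))‖ < r := fun u t ht hb ↦ by
      have e : t = r * ‖(b : EuclideanSpace ℝ (Fin 2) ×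
          Metric.sphere (0 : EuclideanSpace ℝ (Fin 2)) 1).1‖ := by
        have := congrArg norm hb
        rw [norm_smul, norm_smul, norm_eq_of_mem_sphere, mul_one, Real.norm_of_nonneg hr.le,
          Real.norm_of_nonneg ht.1.le] at this
        exact this.symm
      rw [norm_smul, norm_eq_of_mem_sphere, mul_one, Real.norm_of_nonneg ht.1.le, e]
      exact mul_lt_of_lt_one_right hr hb1
    constructor
    · rintro ⟨u, t, ht', hb, ha⟩
      refine ⟨u, t, ht', hb, ?_⟩
      have := congrArg ψ ha
      rwa [Diffeomorph.apply_symm_apply, hconj i u _ (ht u t ht' hb)] at this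
    · rintro ⟨u, t, ht', hb, ha⟩
      refine ⟨u, t, ht', hb, ?_⟩
      rw [ha, ← hconj i u _ (ht u t ht' hb), Diffeomorph.symm_apply_apply]
  have hAψ : Manifold.IsSmoothEmbedding (𝓡 3) (𝓡 3) ∞ (jA ∘ Link.complDiffeoSymm ψ L.toLink hψL) :=
    isSmoothEmbedding_comp_diffeomorph hA _
  have hAψo : IsOpen (range (jA ∘ Link.complDiffeoSymm ψ L.toLink hψL)) := by
    rw [Link.range_comp_complDiffeoSymm]; exact hAo
  have hUψ : range (jA ∘ Link.complDiffeoSymm ψ L.toLink hψL) ∪ (⋃ i, range (jB i)) = univ := by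
    rw [Link.range_comp_complDiffeoSymm]; exact hU
  exact nonempty_diffeomorph_of_multiGluing hAψ hAψo hB hUψ hBd hglue hA' hAo' hB' hU' hBd' hR'

end Discharge

end Literature.Topology.FourManifolds
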